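import Summits.AtomisticToContinuum.Crystallization.Theorems.ExcessDecayLiouvillePhononStabilityCertMetric

/-!
# Near-certificate layer IX: the metric (`ψ`) and stability (`κ`) terms of the target

Support file for crux `PhononStability` (stmt-AtomisticToContinuum-9333), line `contragredient-window-collapse`
(lead c2).  With the `Ĥ`-elimination of `…CertMetric.lean` the two `Ĥ`-dependent pieces of the near form become
polynomial pair forms in the strain variables `x₁ … x₆` (through `X = Ĝ − G_c = Σ_v x_v · XPc v`):

* `ψ(‖Aζ_c‖) · Y_c ≥ Q(Δρ_c) · pair(c, H_c − H_c X H_c) − q · (200/189)² · pair(c, M⁺)` for a checked lower model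
  `Q ≤ ψ̃` on the class's length range, `|Q| ≤ q` there, and the CONSTANT majorant
  `M⁺ = (Σ_v h_v) · Σ_v h_v (XPc_v H_c)ᵀ M₀⁻¹ (XPc_v H_c) ⪰ (X H_c)ᵀ M₀⁻¹ (X H_c)` on the box `|x_v| ≤ h_v` (`psiTerm_le`);
* `−2κ · Y_c ≥ −2κ · pair(c, H_c − H_c X H_c) − 2κ (200/189)² · pair(c, M⁺)` (`kappaTerm_le`).

Rational 3×3 matrix bookkeeping, the coefficient matrices `XPc` of the linear chart polynomials `XP`, the polynomial
matrix `lowMatL` and its evaluation, the majorant and a crude absolute bound of a univariate polynomial. [folklore]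
-/

noncomputable section

open scoped BigOperators Classical InnerProductSpace Matrix
open Filter Set Function
open Summit.AtomisticToContinuum.Crystallization.Theorems.PhononStabilityNegative

namespace Summit.AtomisticToContinuum.Crystallization.Theorems.PhononStabilityCWC.Cert

local notation "E3" => EuclideanSpace ℝ (Fin 3)
local notation "M3" => Matrix (Fin 3) (Fin 3) ℝ

/-! ## Rational 3×3 matrices -/

/-- product of rational matrices -/
def mmul (P Q : Mat) : Mat := fun i j => ∑ k, P i k * Q k j
/-- transpose -/
def mtrans (P : Mat) : Mat := fun i j => P j i
/-- scalar multiple -/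
def mscale (a : ℚ) (P : Mat) : Mat := fun i j => a * P i j
/-- sum of matrices -/
def madd (P Q : Mat) : Mat := fun i j => P i j + Q i j
/-- the identity -/
def oneQ : Mat := fun i j => if i = j then 1 else 0
/-- entrywise equality test -/
def matEqB (P Q : Mat) : Bool := decide (∀ i j, P i j = Q i j)

/-- `castMat` of a product. [folklore] -/
theorem castMat_mmul (P Q : Mat) : castMat (mmul P Q) = castMat P * castMat Q := by
  ext i j; simp [castMat, mmul, Matrix.mul_apply]

/-- `castMat` of a transpose. [folklore] -/
theorem castMat_mtrans (P : Mat) : castMat (mtrans P) = (castMat P)ᵀ := by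
  ext i j; simp [castMat, mtrans]

/-- `castMat` of a scalar multiple. [folklore] -/
theorem castMat_mscale (a : ℚ) (P : Mat) : castMat (mscale a P) = (a : ℝ) • castMat P := by
  ext i j; simp [castMat, mscale]

/-- `castMat` of a sum. [folklore] -/
theorem castMat_madd (P Q : Mat) : castMat (madd P Q) = castMat P + castMat Q := by
  ext i j; simp [castMat, madd]

/-- `castMat oneQ = 1`. [folklore] -/
theorem castMat_oneQ : castMat oneQ = 1 := by
  ext i j
  simp only [castMat, oneQ, Matrix.of_apply, Matrix.one_apply]
  split_ifs <;> simp

/-- equal matrices from the test. [folklore] -/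
theorem eq_of_matEqB {P Q : Mat} (h : matEqB P Q = true) : P = Q := by
  unfold matEqB at h; rw [decide_eq_true_eq] at h; funext i j; exact h i j

/-- a checked inverse pair: `castMat P * castMat Q = 1`. [folklore] -/
theorem castMat_mul_eq_one {P Q : Mat} (h : matEqB (mmul P Q) oneQ = true) : castMat P * castMat Q = 1 := by
  rw [← castMat_mmul, eq_of_matEqB h, castMat_oneQ]

/-- a checked symmetric matrix: `(castMat P)ᵀ = castMat P`. [folklore] -/
theorem castMat_transpose_eq {P : Mat} (h : matEqB (mtrans P) P = true) : (castMat P)ᵀ = castMat P := by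
  rw [← castMat_mtrans, eq_of_matEqB h]

/-! ## The strain deviation as a linear combination of fixed rational matrices -/

/-- coefficient matrix of the variable `v ∈ {1,…,6}` in the linear chart polynomials `XP` -/
def XPc (v : ℕ) : Mat := fun i j =>
  match v, i, j with
  | 1, 0, 0 => 1 | 1, 0, 1 => 1 / 2 | 1, 1, 0 => 1 / 2
  | 2, 1, 1 => 1 | 2, 0, 1 => 1 / 2 | 2, 1, 0 => 1 / 2
  | 3, 0, 1 => -1 / 2 | 3, 1, 0 => -1 / 2
  | 4, 0, 2 => 80 / 49 | 4, 2, 0 => 80 / 49 | 4, 1, 2 => 40 / 49 | 4, 2, 1 => 40 / 49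
  | 5, 1, 2 => 70 / 49 | 5, 2, 1 => 70 / 49
  | 6, 2, 2 => 6400 / 2401
  | _, _, _ => 0

/-- the six strain variables, indexed by `Fin 6` -/
def sv (v : Fin 6) : ℕ := v.val + 1

/-- `XP i j = Σ_v x_{sv v} · XPc (sv v) i j`. [folklore] -/
theorem spEval_XP (i j : Fin 3) (x : ℕ → ℝ) :
    spEval (XP i j) x = ∑ v : Fin 6, x (sv v) * (XPc (sv v) i j : ℝ) := by
  fin_cases i <;> fin_cases j <;>
    simp [XP, XPc, sv, spEval, monoVal, Fin.sum_univ_succ]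

/-- **`Ĝ − G_c = Σ_v x_v · XPc v`** at the chart assignment. [folklore] -/
theorem gMat_sub_castG (C : CellData) (A B : E3 →L[ℝ] E3) (δ : E3) :
    gMat A - castMat C.G = ∑ v : Fin 6, (chartX C A B δ (sv v)) • castMat (XPc (sv v)) := by
  ext i j
  have h := matVal_XP C A B δ i j
  rw [spEval_XP] at h
  simp only [Matrix.sub_apply, gMat_apply, castMat_apply, Matrix.sum_apply, Matrix.smul_apply, smul_eq_mul]
  rw [← h]

/-! ## The polynomial matrix `H_c − H_c X H_c` -/

/-- `P_v = XPc_v` sandwiched: `H_c XPc_v H_c` -/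
def hxh (Hc : Mat) (v : Fin 6) : Mat := mmul (mmul Hc (XPc (sv v))) Hc

/-- `H_c − H_c X H_c` as a polynomial matrix (constant + linear in `x₁ … x₆`) -/
def lowMatL (Hc : Mat) : List (Mono × Mat) :=
  ([], Hc) :: (List.finRange 6).map fun v => ([sv v], mscale (-1) (hxh Hc v))

/-- `matVal` of a cons. [folklore] -/
theorem matVal_cons (x : ℕ → ℝ) (e : Mono × Mat) (L : List (Mono × Mat)) (i j : Fin 3) :
    matVal x (e :: L) i j = monoVal x e.1 * (e.2 i j : ℝ) + matVal x L i j := by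
  simp [matVal]

/-- `matVal` of a list mapped from `finRange`. [folklore] -/
theorem matVal_map_finRange {n : ℕ} (x : ℕ → ℝ) (g : Fin n → Mono × Mat) (i j : Fin 3) :
    matVal x ((List.finRange n).map g) i j = ∑ v : Fin n, monoVal x (g v).1 * ((g v).2 i j : ℝ) := by
  simp only [matVal, List.map_map]
  rw [← List.ofFn_eq_map, List.sum_ofFn]
  rfl

/-- **the value of `lowMatL` is `lowMat`.** [folklore] -/
theorem matVal_lowMatL (C : CellData) (Hc : Mat) (A B : E3 →L[ℝ] E3) (δ : E3) (i j : Fin 3) :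
    matVal (chartX C A B δ) (lowMatL Hc) i j = lowMat A (castMat C.G) (castMat Hc) i j := by
  set x := chartX C A B δ
  rw [lowMatL, matVal_cons, matVal_map_finRange, lowMat, gMat_sub_castG C A B δ]
  rw [Matrix.mul_sum, Matrix.sum_mul]
  simp only [Matrix.sub_apply, Matrix.sum_apply, castMat_apply, monoVal, List.map_nil, List.prod_nil, one_mul,
    List.map_cons, List.prod_cons, mul_one, Matrix.mul_smul, Matrix.smul_mul, Matrix.smul_apply, smul_eq_mul]
  rw [sub_eq_add_neg, ← Finset.sum_neg_distrib]
  congr 1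
  refine Finset.sum_congr rfl fun v _ => ?_
  simp only [hxh, mmul, mscale, castMat_apply, Matrix.mul_apply, Fin.sum_univ_three]
  push_cast
  ring

/-! ## The constant majorant of `(X H_c)ᵀ M₀⁻¹ (X H_c)` on a box -/

/-- `P_v = XPc_v H_c` -/
def xh (Hc : Mat) (v : Fin 6) : Mat := mmul (XPc (sv v)) Hc

/-- `M⁺ = (Σ_v h_v) · Σ_v h_v P_vᵀ M₀⁻¹ P_v` (box half-widths `hs` of the strain variables) -/
def majConst (Hc : Mat) (hs : Fin 6 → ℚ) : Mat :=
  mscale (∑ v, hs v) fun i j => ∑ v, hs v * (mmul (mmul (mtrans (xh Hc v)) M0inv) (xh Hc v)) i j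

/-- the vector `u_v(z) = Σ_k (P_v z)_k dgen_k`. -/
def uvec (Hc : Mat) (v : Fin 6) (z : Fin 3 → ℝ) : E3 := ∑ k, (castMat (xh Hc v) *ᵥ z) k • dgen k

/-- `zᵀ P_vᵀ M₀⁻¹ P_v z = ‖u_v(z)‖²`. [folklore] -/
theorem dotProduct_xh (Hc : Mat) (v : Fin 6) (z : Fin 3 → ℝ) :
    z ⬝ᵥ (castMat (mmul (mmul (mtrans (xh Hc v)) M0inv) (xh Hc v)) *ᵥ z) = ‖uvec Hc v z‖ ^ 2 := by
  rw [castMat_mmul, castMat_mmul, castMat_mtrans, ← Matrix.mulVec_mulVec, ← Matrix.mulVec_mulVec,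
    Matrix.dotProduct_mulVec, Matrix.vecMul_transpose, uvec, ← dotProduct_m0_eq]

/-- `(X H_c) z` expands over the strain variables. [folklore] -/
theorem xhc_mulVec (C : CellData) (Hc : Mat) (A B : E3 →L[ℝ] E3) (δ : E3) (z : Fin 3 → ℝ) :
    ((gMat A - castMat C.G) * castMat Hc) *ᵥ z = ∑ v : Fin 6, chartX C A B δ (sv v) • (castMat (xh Hc v) *ᵥ z) := by
  rw [gMat_sub_castG C A B δ, Matrix.sum_mul, Matrix.sum_mulVec]
  refine Finset.sum_congr rfl fun v _ => ?_
  rw [Matrix.smul_mul, Matrix.smul_mulVec, xh, castMat_mmul]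

/-- **the majorant bounds the quadratic form** on the box `|x_{sv v}| ≤ hs v`. [folklore] -/
theorem majMat_le_majConst (C : CellData) (Hc : Mat) (hs : Fin 6 → ℚ) (A B : E3 →L[ℝ] E3) (δ : E3)
    (hbox : ∀ v : Fin 6, |chartX C A B δ (sv v)| ≤ hs v) (z : Fin 3 → ℝ) :
    z ⬝ᵥ (majMat A (castMat C.G) (castMat Hc) *ᵥ z) ≤ z ⬝ᵥ (castMat (majConst Hc hs) *ᵥ z) := by
  set x := chartX C A B δ
  -- left side = ‖Σ_v x_v u_v‖²
  have hL : z ⬝ᵥ (majMat A (castMat C.G) (castMat Hc) *ᵥ z) = ‖∑ v : Fin 6, x (sv v) • uvec Hc v z‖ ^ 2 := by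
    rw [majMat, ← Matrix.mulVec_mulVec, ← Matrix.mulVec_mulVec, Matrix.dotProduct_mulVec, Matrix.vecMul_transpose,
      xhc_mulVec C Hc A B δ, dotProduct_m0_eq]
    congr 2
    simp only [uvec, Finset.smul_sum, smul_smul]
    rw [Finset.sum_comm]
    refine Finset.sum_congr rfl fun k _ => ?_
    rw [← Finset.sum_smul]
    congr 1
  -- right side = (Σ h) Σ h_v ‖u_v‖²
  have hR : z ⬝ᵥ (castMat (majConst Hc hs) *ᵥ z) = (∑ v, (hs v : ℝ)) * ∑ v, (hs v : ℝ) * ‖uvec Hc v z‖ ^ 2 := by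
    have hc : castMat (majConst Hc hs) =
        (∑ v, (hs v : ℝ)) • ∑ v, (hs v : ℝ) • castMat (mmul (mmul (mtrans (xh Hc v)) M0inv) (xh Hc v)) := by
      ext i j
      simp [majConst, castMat, mscale, Matrix.sum_apply, Matrix.smul_apply, Finset.mul_sum]
    rw [hc, Matrix.smul_mulVec, dotProduct_smul, Matrix.sum_mulVec, dotProduct_sum, smul_eq_mul]
    congr 1
    refine Finset.sum_congr rfl fun v _ => ?_
    rw [Matrix.smul_mulVec, dotProduct_smul, dotProduct_xh, smul_eq_mul]
  rw [hL, hR]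
  -- ‖Σ x_v u_v‖ ≤ Σ |x_v| ‖u_v‖, then Cauchy–Schwarz and |x_v| ≤ h_v
  have h1 : ‖∑ v : Fin 6, x (sv v) • uvec Hc v z‖ ≤ ∑ v : Fin 6, |x (sv v)| * ‖uvec Hc v z‖ := by
    refine (norm_sum_le _ _).trans (le_of_eq (Finset.sum_congr rfl fun v _ => ?_))
    rw [norm_smul, Real.norm_eq_abs]
  have h0 : 0 ≤ ∑ v : Fin 6, |x (sv v)| * ‖uvec Hc v z‖ := Finset.sum_nonneg fun v _ => by positivity
  have h2 : ‖∑ v : Fin 6, x (sv v) • uvec Hc v z‖ ^ 2 ≤ (∑ v : Fin 6, |x (sv v)| * ‖uvec Hc v z‖) ^ 2 :=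
    pow_le_pow_left₀ (norm_nonneg _) h1 2
  have h3 : (∑ v : Fin 6, |x (sv v)| * ‖uvec Hc v z‖) ^ 2 ≤
      (∑ v : Fin 6, |x (sv v)|) * ∑ v : Fin 6, |x (sv v)| * ‖uvec Hc v z‖ ^ 2 := by
    have := Finset.sum_mul_sq_le_sq_mul_sq Finset.univ (fun v : Fin 6 => Real.sqrt |x (sv v)|)
      (fun v : Fin 6 => Real.sqrt |x (sv v)| * ‖uvec Hc v z‖)
    have e1 : ∀ v : Fin 6, Real.sqrt |x (sv v)| * (Real.sqrt |x (sv v)| * ‖uvec Hc v z‖) = |x (sv v)| * ‖uvec Hc v z‖ := by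
      intro v; rw [← mul_assoc, Real.mul_self_sqrt (abs_nonneg _)]
    have e2 : ∀ v : Fin 6, Real.sqrt |x (sv v)| ^ 2 = |x (sv v)| := fun v => Real.sq_sqrt (abs_nonneg _)
    have e3 : ∀ v : Fin 6, (Real.sqrt |x (sv v)| * ‖uvec Hc v z‖) ^ 2 = |x (sv v)| * ‖uvec Hc v z‖ ^ 2 := by
      intro v; rw [mul_pow, e2]
    simp only [e1, e2, e3] at this
    exact this
  have h4 : (∑ v : Fin 6, |x (sv v)|) * ∑ v : Fin 6, |x (sv v)| * ‖uvec Hc v z‖ ^ 2 ≤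
      (∑ v, (hs v : ℝ)) * ∑ v, (hs v : ℝ) * ‖uvec Hc v z‖ ^ 2 := by
    have ha : ∑ v : Fin 6, |x (sv v)| ≤ ∑ v, (hs v : ℝ) := Finset.sum_le_sum fun v _ => hbox v
    have hb : ∑ v : Fin 6, |x (sv v)| * ‖uvec Hc v z‖ ^ 2 ≤ ∑ v, (hs v : ℝ) * ‖uvec Hc v z‖ ^ 2 :=
      Finset.sum_le_sum fun v _ => mul_le_mul_of_nonneg_right (hbox v) (sq_nonneg _)
    have hpos1 : 0 ≤ ∑ v : Fin 6, |x (sv v)| * ‖uvec Hc v z‖ ^ 2 := Finset.sum_nonneg fun v _ => by positivity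
    have hpos2 : 0 ≤ ∑ v, (hs v : ℝ) := le_trans (Finset.sum_nonneg fun v _ => abs_nonneg _) ha
    exact mul_le_mul ha hb hpos1 hpos2
  linarith

/-- **pair-form majorant:** `pair(c, (X H_c)ᵀ M₀⁻¹ (X H_c)) ≤ pair(c, M⁺)` on the strain box. [folklore] -/
theorem pairEvalR_majMat_le (C : CellData) (Hc : Mat) (hs : Fin 6 → ℚ) (A B : E3 →L[ℝ] E3) (δ : E3)
    (hbox : ∀ v : Fin 6, |chartX C A B δ (sv v)| ≤ hs v) (c : BondClass) {w : Label → E3}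
    (hw : (support w).Finite) :
    pairEvalR c (majMat A (castMat C.G) (castMat Hc)) w ≤ pairEvalR c (castMat (majConst Hc hs)) w := by
  unfold pairEvalR
  refine Summable.tsum_le_tsum (fun k => ?_) (summable_pairR hw c _) (summable_pairR hw c _)
  rw [bilR_eq_dotProduct, bilR_eq_dotProduct]
  exact majMat_le_majConst C Hc hs A B δ hbox _

/-! ## Crude absolute bound of a univariate polynomial on `[−h, h]` -/

/-- `|c₀| + Σ_{k≥1} |c_k| h^k` -/
def uAbsBound (Q : UPoly) (h : ℚ) : ℚ :=
  match Q with
  | [] => 0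
  | c :: q => |c| + utailBound q h

/-- `|Q(t)| ≤ uAbsBound Q h` for `|t| ≤ h`. [folklore] -/
theorem abs_ueval_le_uAbsBound (Q : UPoly) {h : ℚ} {t : ℝ} (ht : |t| ≤ h) : |ueval Q t| ≤ (uAbsBound Q h : ℝ) := by
  match Q with
  | [] => simp [uAbsBound]
  | c :: q =>
      simp only [uAbsBound, ueval_cons, Rat.cast_add, Rat.cast_abs]
      have h1 := abs_ueval_le q ht 0
      rw [pow_one] at h1
      unfold utailBound
      rw [utailBound_cast]
      exact (abs_add_le _ _).trans (add_le_add le_rfl h1)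

/-! ## The `ψ`-term and the `κ`-term -/

/-- the `ψ`-term of a nearest-neighbour class: `Q(Δρ_c) · pair(c, H_c − H_c X H_c) − q (200/189)² · pair(c, M⁺)` -/
def psiTermPPF (C : CellData) (Hc : Mat) (hs : Fin 6 → ℚ) (c : BondClass) (Q : UPoly) (qabs : ℚ) : PolyPF :=
  mulSP (ucompose Q (rhoPoly C c)) (classPPF c (lowMatL Hc)) ++
    classPPF c [([], mscale (-(qabs * (200 / 189) ^ 2)) (majConst Hc hs))]

/-- the `κ`-term of a nearest-neighbour class: `−2κ · pair(c, H_c − H_c X H_c) − 2κ (200/189)² · pair(c, M⁺)` -/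
def kappaTermPPF (Hc : Mat) (hs : Fin 6 → ℚ) (κ : ℚ) (c : BondClass) : PolyPF :=
  mulSP [([], -(2 * κ))] (classPPF c (lowMatL Hc)) ++
    classPPF c [([], mscale (-(2 * κ * (200 / 189) ^ 2)) (majConst Hc hs))]

/-- scaling a rational matrix scales its pair form. [folklore] -/
theorem castFun_mscale (a : ℚ) (M : Mat) :
    (fun i j => ((mscale a M i j : ℚ) : ℝ)) = fun i j => (a : ℝ) * castMat M i j := by
  funext i j; simp only [mscale, castMat_apply, Rat.cast_mul]

/-- `matVal` of a singleton constant entry. [folklore] -/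
theorem matVal_single (x : ℕ → ℝ) (M : Mat) : matVal x [([], M)] = fun i j => (M i j : ℝ) := by
  funext i j; simp [matVal, monoVal]

section Validity

variable (C : CellData) (Hc : Mat) (hs : Fin 6 → ℚ) (A B : E3 →L[ℝ] E3) (δ : E3) (c : BondClass)
  (hW : CellWindow A) (hAB : Contragredient A B)
  (hinv : matEqB (mmul Hc C.G) oneQ = true) (hsym : matEqB (mtrans Hc) Hc = true)
  (hbox : ∀ v : Fin 6, |chartX C A B δ (sv v)| ≤ hs v)
  {w : Label → E3} (hw : (support w).Finite)

include hW hAB hinv hsym hbox hw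

/-- the common lower bound of `pair(c, Ĥ)` against the polynomial part and the majorant:
for `a ≤ ψ`-type coefficients. [folklore] -/
theorem pairEvalR_hhat_lower {a b q : ℝ} (hab : a ≤ b) (habs : |a| ≤ q) (hq : 0 ≤ q) :
    a * pairEvalR c (fun i j => matVal (chartX C A B δ) (lowMatL Hc) i j) w -
        q * (200 / 189) ^ 2 * pairEvalR c (castMat (majConst Hc hs)) w ≤
      b * pairEvalR c (hhat B) w := by
  have h2 : castMat Hc * castMat C.G = 1 := castMat_mul_eq_one hinv
  have hHcT : (castMat Hc)ᵀ = castMat Hc := castMat_transpose_eq hsym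
  -- `G_c H_c = 1` from `H_c G_c = 1` (square matrices)
  have h1 : castMat C.G * castMat Hc = 1 := mul_eq_one_comm.mp h2
  have hsplit := pairEvalR_hhat_split (A := A) hAB h2 c hw
  have hpsd0 := pairEvalR_psd_nonneg A B hHcT c w
  have hpsd1 := pairEvalR_psd_le hW hAB h1 hHcT c hw
  have hmaj := pairEvalR_majMat_le C Hc hs A B δ hbox c hw
  have hnn : 0 ≤ pairEvalR c (hhat B) w := pairEvalR_hhat_nonneg B c w
  have hlow : pairEvalR c (fun i j => matVal (chartX C A B δ) (lowMatL Hc) i j) w =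
      pairEvalR c (lowMat A (castMat C.G) (castMat Hc)) w := by
    congr 1; funext i j; exact matVal_lowMatL C Hc A B δ i j
  rw [hlow]
  set L := pairEvalR c (lowMat A (castMat C.G) (castMat Hc)) w
  set P := pairEvalR c (psdMat A B (castMat Hc)) w
  set M := pairEvalR c (castMat (majConst Hc hs)) w
  have hK : 0 ≤ (200 / 189 : ℝ) ^ 2 := by positivity
  -- b (L + P) ≥ a (L + P) = a L + a P ≥ a L − |a| P ≥ a L − q P ≥ a L − q K M
  have s1 : a * (L + P) ≤ b * (L + P) := by rw [← hsplit]; exact mul_le_mul_of_nonneg_right hab hnn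
  have s2 : -(|a| * P) ≤ a * P := by
    have := neg_abs_le a
    nlinarith
  have s3 : |a| * P ≤ q * P := mul_le_mul_of_nonneg_right habs hpsd0
  have s4 : q * P ≤ q * ((200 / 189) ^ 2 * pairEvalR c (majMat A (castMat C.G) (castMat Hc)) w) :=
    mul_le_mul_of_nonneg_left hpsd1 hq
  have s5 : q * ((200 / 189) ^ 2 * pairEvalR c (majMat A (castMat C.G) (castMat Hc)) w) ≤ q * ((200 / 189) ^ 2 * M) :=
    mul_le_mul_of_nonneg_left (mul_le_mul_of_nonneg_left hmaj hK) hq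
  rw [hsplit]
  nlinarith

/-- **validity of the `ψ`-term.** -/
theorem psiTerm_le (Q : UPoly) (qabs : ℚ) (h : ℚ) (hchk : nonnegDoubleRoot (psiNum (C.rhoc c) Q) h = true)
    (hq : uAbsBound Q h ≤ qabs) (hth : |‖A (bondVec δ c)‖ ^ 2 - C.rhoc c| ≤ (h : ℝ))
    (hpos : 0 < ‖A (bondVec δ c)‖) :
    evalPPF (psiTermPPF C Hc hs c Q qabs) (chartX C A B δ) w ≤ psiLJ ‖A (bondVec δ c)‖ * metricForm B c w := by
  have hrho := rho_eq chartIdentities C A B δ c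
  have ht : |spEval (rhoPoly C c) (chartX C A B δ)| ≤ h := by
    rwa [show spEval (rhoPoly C c) (chartX C A B δ) = ‖A (bondVec δ c)‖ ^ 2 - C.rhoc c by linarith]
  have hpos' : 0 < (C.rhoc c : ℝ) + spEval (rhoPoly C c) (chartX C A B δ) := by rw [← hrho]; positivity
  have hmodel := model_le_psiT hchk ht hpos'
  have habs : |ueval Q (spEval (rhoPoly C c) (chartX C A B δ))| ≤ (qabs : ℝ) := by
    have h1 := abs_ueval_le_uAbsBound Q (h := h) (t := spEval (rhoPoly C c) (chartX C A B δ)) ht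
    have h2 : ((uAbsBound Q h : ℚ) : ℝ) ≤ qabs := by exact_mod_cast hq
    exact h1.trans h2
  have hq0 : (0 : ℝ) ≤ qabs := (abs_nonneg _).trans habs
  have key := pairEvalR_hhat_lower C Hc hs A B δ c hW hAB hinv hsym hbox hw hmodel habs hq0
  have hsc : pairEvalR c (fun i j => ((mscale (-(qabs * (200 / 189) ^ 2)) (majConst Hc hs) i j : ℚ) : ℝ)) w =
      -(qabs * (200 / 189) ^ 2) * pairEvalR c (castMat (majConst Hc hs)) w := by
    rw [castFun_mscale, pairEvalR_smul]; push_cast; ring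
  have hL : evalPPF (psiTermPPF C Hc hs c Q qabs) (chartX C A B δ) w =
      ueval Q (spEval (rhoPoly C c) (chartX C A B δ)) *
          pairEvalR c (fun i j => matVal (chartX C A B δ) (lowMatL Hc) i j) w -
        qabs * (200 / 189) ^ 2 * pairEvalR c (castMat (majConst Hc hs)) w := by
    unfold psiTermPPF
    rw [evalPPF_append, evalPPF_mulSP, spEval_ucompose, evalPPF_classPPF hw, evalPPF_classPPF hw, matVal_single, hsc]
    ring
  have hR : psiLJ ‖A (bondVec δ c)‖ * metricForm B c w =
      psiT ((C.rhoc c : ℝ) + spEval (rhoPoly C c) (chartX C A B δ)) * pairEvalR c (hhat B) w := by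
    rw [psiLJ_eq_psiT, hrho, metricForm_eq_pairEvalR]
  rw [hL, hR]
  exact key

/-- **validity of the `κ`-term.** -/
theorem kappaTerm_le (κ : ℚ) (hκ : 0 ≤ κ) :
    evalPPF (kappaTermPPF Hc hs κ c) (chartX C A B δ) w ≤ -(2 * κ) * metricForm B c w := by
  unfold kappaTermPPF
  rw [evalPPF_append, evalPPF_mulSP, evalPPF_classPPF hw, evalPPF_classPPF hw, matVal_single, metricForm_eq_pairEvalR]
  have hsc : pairEvalR c (fun i j => ((mscale (-(2 * κ * (200 / 189) ^ 2)) (majConst Hc hs) i j : ℚ) : ℝ)) w =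
      -(2 * κ * (200 / 189) ^ 2) * pairEvalR c (castMat (majConst Hc hs)) w := by
    rw [castFun_mscale, pairEvalR_smul]; push_cast; ring
  have hsp : spEval [([], -(2 * κ))] (chartX C A B δ) = -(2 * κ) := by simp [spEval, monoVal]
  rw [hsc, hsp]
  have habs : |(-(2 * κ) : ℝ)| ≤ 2 * κ := by rw [abs_neg, abs_of_nonneg (by positivity)]
  have key := pairEvalR_hhat_lower C Hc hs A B δ c hW hAB hinv hsym hbox hw (le_refl (-(2 * (κ : ℝ)))) habs (by positivity)
  linarith

end Validity

/-- Anchor of this support file (registered stub of the line skeleton, lead c2). -/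
theorem stub_certPsi : ∀ (p : UPoly) (h : ℚ) (t : ℝ), |t| ≤ h → |ueval p t| ≤ ((|p.headD 0| + utailBound p.tail h : ℚ) : ℝ) :=
  by
  intro p h t ht
  cases p with
  | nil => simp [utailBound]
  | cons c q =>
      have := abs_ueval_le_uAbsBound (c :: q) ht
      simpa [uAbsBound] using this

end Summit.AtomisticToContinuum.Crystallization.Theorems.PhononStabilityCWC.Cert

end
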